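import Literature.Topology.FourManifolds.SlideSetup4
import HarnessLib

/-!
# The slide set-up, V: the parameter record with a prescribed smaller tip depth

Topic `Literature/Topology/FourManifolds`; fact seat `provefact-IsStrictHandleSlide.isSurgery`
(R. C. Kirby, *The Topology of 4-Manifolds*, LNM 1374 (1989), Ch. I §4, Fig. 4.2; remaining content:
the named fact (S) `Literature.Topology.FourManifolds.FramedLink.IsStrictHandleSlide.slideModel`).
Every condition of a `SlideChoice` on the tip depth has the form `κ_D · A ≤ B` with `A ≥ 0`
(`SlideSetup4`), so the record built from a `PreChoice` admits any smaller positive tip depth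
`κ' ≤ κ_D` (`PreChoice.toSlideChoice'`); hence for every bound `κmax > 0` there is a
`SlideChoice` with `κ_D ≤ κmax` (`exists_slideChoice_le`) — used to keep the tips inside the flat
strip of the band and the stubs short.

## References

* R. C. Kirby, *The Topology of 4-Manifolds*, LNM 1374, Springer (1989), Ch. I §4. [Kirby1989]
-/

open scoped Topology ContDiff
open Set Real Filter

noncomputable section

namespace Literature.Topology.FourManifolds

namespace BandCore

variable {A B : Knot} {avoid : Set (Metric.sphere (0 : EuclideanSpace ℝ (Fin 4)) 1)} {c : BandCore A B avoid}

namespace PreChoice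

variable {e : ℝ → ℝ} (Q : c.PreChoice e)

/-- **Stage B′: the full parameter record with any smaller tip depth `κ' ≤ κ_D`.** [cite: Kirby1989, Ch. I §4] -/
def toSlideChoice' (κ' : ℝ) (hκ0 : 0 < κ') (hle : κ' ≤ Q.κD) : c.SlideChoice e where
  CT := Q.CT
  CT_ge := Q.CT_ge
  CT_nonneg := Q.CT_nonneg
  emin := Q.emin
  emax := Q.emax
  Me := Q.Me
  emin_pos := Q.emin_pos
  e_bounds := Q.e_bounds
  e_deriv := Q.e_deriv
  mΘ := Q.mΘ
  MΘ := Q.MΘ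
  mΘ_pos := Q.mΘ_pos
  Θ_deriv := Q.Θ_deriv
  μ := Q.μ
  μ_pos := Q.μ_pos
  μ_le := Q.μ_le
  μ_angle := Q.μ_angle
  Mρ := Q.Mρ
  Mρ_pos := Q.Mρ_pos
  Mρ_geₗ := Q.Mρ_geₗ
  Mρ_geᵤ := Q.Mρ_geᵤ
  ms := Q.ms
  ms_geₗ := Q.ms_geₗ
  ms_geᵤ := Q.ms_geᵤ
  N := Q.N
  N_ge := Q.N_ge
  lam := Q.lam
  lam_pos := Q.lam_pos
  lam_leₗ := Q.lam_leₗ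
  lam_leᵤ := Q.lam_leᵤ
  lam_gentle := Q.lam_gentle
  lam_clamp := Q.lam_clamp
  κD := κ'
  κD_pos := hκ0
  κD_leₖ := by have h := le_trans (mul_le_mul_of_nonneg_right hle A_k_nonneg) Q.half_k; have := liteKmaxGen_pos Q.ms_pos; linarith
  κD_μ := by have h := le_trans (mul_le_mul_of_nonneg_right hle Q.A_mu_nonneg) Q.half_mu; have := Q.μ_pos; linarith
  κD_e := by have h := le_trans (mul_le_mul_of_nonneg_right hle Q.A_e1_nonneg) Q.half_e1; have := Q.emin_pos; linarith
  κD_e' := by have h := le_trans (mul_le_mul_of_nonneg_right hle Q.A_e2_nonneg) Q.half_e2; linarith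
  κD_Meₗ := by have h := le_trans (mul_le_mul_of_nonneg_right hle Q.A_Mel_nonneg) Q.half_Mel; have := Q.B_Mel_pos; linarith
  κD_Meᵤ := by have h := le_trans (mul_le_mul_of_nonneg_right hle Q.A_Meu_nonneg) Q.half_Meu; have := Q.B_Meu_pos; linarith
  cond1ₗ := by have h := le_trans (mul_le_mul_of_nonneg_right hle Q.A_c1l_nonneg) Q.half_c1l; have := Q.B_c1l_pos; linarith
  cond_sₗ := by
    have h := le_trans (mul_le_mul_of_nonneg_right hle Q.A_csl_nonneg) Q.half_csl
    have e1 : c.cmax * κ' * Q.emax + c.qmaxc * Q.MΘ * routeMH' c.liteMH Q.ms Q.CT Q.Mρ * κ' / c.liteVmin2 Q.μ_pos =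
        κ' * (c.cmax * Q.emax + c.qmaxc * Q.MΘ * routeMH' c.liteMH Q.ms Q.CT Q.Mρ / c.liteVmin2 Q.μ_pos) := by ring
    rw [e1]; linarith
  cond2ₗ := by
    have h := le_trans (mul_le_mul_of_nonneg_right hle Q.A_c2l_nonneg) Q.half_c2l
    have e1 : 4 * c.cmax * (c.cmax * κ' * Q.emax + c.qmaxc * Q.MΘ * routeMH' c.liteMH Q.ms Q.CT Q.Mρ * κ' / c.liteVmin2 Q.μ_pos) =
        κ' * (4 * c.cmax * (c.cmax * Q.emax + c.qmaxc * Q.MΘ * routeMH' c.liteMH Q.ms Q.CT Q.Mρ / c.liteVmin2 Q.μ_pos)) := by ring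
    rw [e1]; linarith
  cond3ₗ := by
    have h := le_trans (mul_le_mul_of_nonneg_right hle Q.A_c3l_nonneg) Q.half_c3l
    have hB := Q.B_c3l_pos
    have e1 : 16 * (c.qmaxc * Q.MΘ * routeMH' c.liteMH Q.ms Q.CT Q.Mρ) *
        (c.cmax * κ' * Q.emax + c.qmaxc * Q.MΘ * routeMH' c.liteMH Q.ms Q.CT Q.Mρ * κ' / c.liteVmin2 Q.μ_pos) =
        κ' * (16 * (c.qmaxc * Q.MΘ * routeMH' c.liteMH Q.ms Q.CT Q.Mρ) *
          (c.cmax * Q.emax + c.qmaxc * Q.MΘ * routeMH' c.liteMH Q.ms Q.CT Q.Mρ / c.liteVmin2 Q.μ_pos)) := by ring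
    rw [e1]; linarith
  cond5ₗ := by
    -- `κD/N · L₁(κD) + cmax κD e₊ ≤ κD (L₁/N + cmax e₊) < κD (1 + cmax e₊) ≤ κD q₋ mΘ ms / 8`
    have hκ : 0 < κ' := hκ0; have hκ1 : κ' ≤ 1 := hle.trans Q.κD_le_one
    have hN := Q.Nₗ; have hcl := Q.climb; have hNpos := Q.N_pos
    have hv := (c.liteVmin2_spec Q.μ_pos).1
    have hMH := Q.MH'ₗ_pos
    set L1 := c.cmax * Q.emax + c.cmax * 1 * Q.Me * routeMH' c.liteMH Q.ms Q.CT Q.Mρ / c.liteVmin2 Q.μ_pos +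
      c.qmaxc * Q.MΘ * routeMH' c.liteMH Q.ms Q.CT Q.Mρ / c.liteVmin2 Q.μ_pos with hL1
    have hX : c.cmax * Q.emax + c.cmax * κ' * Q.Me * routeMH' c.liteMH Q.ms Q.CT Q.Mρ / c.liteVmin2 Q.μ_pos +
        c.qmaxc * Q.MΘ * routeMH' c.liteMH Q.ms Q.CT Q.Mρ / c.liteVmin2 Q.μ_pos ≤ L1 := by
      rw [hL1]
      have : c.cmax * κ' * Q.Me * routeMH' c.liteMH Q.ms Q.CT Q.Mρ / c.liteVmin2 Q.μ_pos ≤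
          c.cmax * 1 * Q.Me * routeMH' c.liteMH Q.ms Q.CT Q.Mρ / c.liteVmin2 Q.μ_pos := by
        apply div_le_div_of_nonneg_right _ hv.le
        have := c.cmax_nonneg; have := Q.Me_nonneg
        exact mul_le_mul_of_nonneg_right (mul_le_mul_of_nonneg_right (mul_le_mul_of_nonneg_left hκ1 c.cmax_nonneg) Q.Me_nonneg) hMH.le
      linarith
    have h1 : κ' / Q.N * (c.cmax * Q.emax + c.cmax * κ' * Q.Me * routeMH' c.liteMH Q.ms Q.CT Q.Mρ / c.liteVmin2 Q.μ_pos +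
        c.qmaxc * Q.MΘ * routeMH' c.liteMH Q.ms Q.CT Q.Mρ / c.liteVmin2 Q.μ_pos) ≤ κ' * (L1 / Q.N) := by
      have := mul_le_mul_of_nonneg_left hX (div_nonneg hκ.le hNpos.le)
      calc _ ≤ κ' / Q.N * L1 := this
        _ = κ' * (L1 / Q.N) := by ring
    have h2 : κ' * (L1 / Q.N) < κ' * 1 := mul_lt_mul_of_pos_left hN hκ
    have h3 : κ' * (c.cmax * Q.emax + 1) ≤ κ' * (c.qminc * Q.mΘ * Q.ms / 8) := mul_le_mul_of_nonneg_left hcl hκ.le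
    nlinarith
  cond1ᵤ := by have h := le_trans (mul_le_mul_of_nonneg_right hle Q.A_c1u_nonneg) Q.half_c1u; have := Q.B_c1u_pos; linarith
  cond_sᵤ := by
    have h := le_trans (mul_le_mul_of_nonneg_right hle Q.A_csu_nonneg) Q.half_csu
    have e1 : c.cmax * κ' * Q.emax + c.qmaxc * Q.MΘ * routeMH' c.liteMHU Q.ms Q.CT Q.Mρ * κ' / c.liteVminU2 Q.μ_pos =
        κ' * (c.cmax * Q.emax + c.qmaxc * Q.MΘ * routeMH' c.liteMHU Q.ms Q.CT Q.Mρ / c.liteVminU2 Q.μ_pos) := by ring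
    rw [e1]; linarith
  cond2ᵤ := by
    have h := le_trans (mul_le_mul_of_nonneg_right hle Q.A_c2u_nonneg) Q.half_c2u
    have e1 : 4 * c.cmax * (c.cmax * κ' * Q.emax + c.qmaxc * Q.MΘ * routeMH' c.liteMHU Q.ms Q.CT Q.Mρ * κ' / c.liteVminU2 Q.μ_pos) =
        κ' * (4 * c.cmax * (c.cmax * Q.emax + c.qmaxc * Q.MΘ * routeMH' c.liteMHU Q.ms Q.CT Q.Mρ / c.liteVminU2 Q.μ_pos)) := by ring
    rw [e1]; linarith
  cond3ᵤ := by
    have h := le_trans (mul_le_mul_of_nonneg_right hle Q.A_c3u_nonneg) Q.half_c3u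
    have hB := Q.B_c3u_pos
    have e1 : 16 * (c.qmaxc * Q.MΘ * routeMH' c.liteMHU Q.ms Q.CT Q.Mρ) *
        (c.cmax * κ' * Q.emax + c.qmaxc * Q.MΘ * routeMH' c.liteMHU Q.ms Q.CT Q.Mρ * κ' / c.liteVminU2 Q.μ_pos) =
        κ' * (16 * (c.qmaxc * Q.MΘ * routeMH' c.liteMHU Q.ms Q.CT Q.Mρ) *
          (c.cmax * Q.emax + c.qmaxc * Q.MΘ * routeMH' c.liteMHU Q.ms Q.CT Q.Mρ / c.liteVminU2 Q.μ_pos)) := by ring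
    rw [e1]; linarith
  cond5ᵤ := by
    have hκ : 0 < κ' := hκ0; have hκ1 : κ' ≤ 1 := hle.trans Q.κD_le_one
    have hN := Q.Nᵤ; have hcl := Q.climb; have hNpos := Q.N_pos
    have hv := (c.liteVminU2_spec Q.μ_pos).1
    have hMH := Q.MH'ᵤ_pos
    set L1 := c.cmax * Q.emax + c.cmax * 1 * Q.Me * routeMH' c.liteMHU Q.ms Q.CT Q.Mρ / c.liteVminU2 Q.μ_pos +
      c.qmaxc * Q.MΘ * routeMH' c.liteMHU Q.ms Q.CT Q.Mρ / c.liteVminU2 Q.μ_pos with hL1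
    have hX : c.cmax * Q.emax + c.cmax * κ' * Q.Me * routeMH' c.liteMHU Q.ms Q.CT Q.Mρ / c.liteVminU2 Q.μ_pos +
        c.qmaxc * Q.MΘ * routeMH' c.liteMHU Q.ms Q.CT Q.Mρ / c.liteVminU2 Q.μ_pos ≤ L1 := by
      rw [hL1]
      have : c.cmax * κ' * Q.Me * routeMH' c.liteMHU Q.ms Q.CT Q.Mρ / c.liteVminU2 Q.μ_pos ≤
          c.cmax * 1 * Q.Me * routeMH' c.liteMHU Q.ms Q.CT Q.Mρ / c.liteVminU2 Q.μ_pos := by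
        apply div_le_div_of_nonneg_right _ hv.le
        exact mul_le_mul_of_nonneg_right (mul_le_mul_of_nonneg_right (mul_le_mul_of_nonneg_left hκ1 c.cmax_nonneg) Q.Me_nonneg) hMH.le
      linarith
    have h1 : κ' / Q.N * (c.cmax * Q.emax + c.cmax * κ' * Q.Me * routeMH' c.liteMHU Q.ms Q.CT Q.Mρ / c.liteVminU2 Q.μ_pos +
        c.qmaxc * Q.MΘ * routeMH' c.liteMHU Q.ms Q.CT Q.Mρ / c.liteVminU2 Q.μ_pos) ≤ κ' * (L1 / Q.N) := by
      have := mul_le_mul_of_nonneg_left hX (div_nonneg hκ.le hNpos.le)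
      calc _ ≤ κ' / Q.N * L1 := this
        _ = κ' * (L1 / Q.N) := by ring
    have h2 : κ' * (L1 / Q.N) < κ' * 1 := mul_lt_mul_of_pos_left hN hκ
    have h3 : κ' * (c.cmax * Q.emax + 1) ≤ κ' * (c.qminc * Q.mΘ * Q.ms / 8) := mul_le_mul_of_nonneg_left hcl hκ.le
    nlinarith
  fingerA := by
    have h := le_trans (mul_le_mul_of_nonneg_right hle Q.A_fA_nonneg) Q.half_fA
    have e1 : Q.MΘ * (κ' * Q.emin / (4 * (Q.Mρ * Q.emax + Q.Me)) + 2 * c.cmax * κ' * Q.emax / (c.qminc * Q.mΘ)) =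
        κ' * (Q.MΘ * (Q.emin / (4 * (Q.Mρ * Q.emax + Q.Me)) + 2 * c.cmax * Q.emax / (c.qminc * Q.mΘ))) := by ring
    rw [e1]; linarith [c.θlow_pos]
  fingerB := by have h := le_trans (mul_le_mul_of_nonneg_right hle Q.A_fB_nonneg) Q.half_fB; have := Q.B_fB_pos; linarith
  fingerMeet := by have h := le_trans (mul_le_mul_of_nonneg_right hle Q.A_fM_nonneg) Q.half_fM; have := Q.lam_pos; linarith
  β_small := by
    have h := le_trans (mul_le_mul_of_nonneg_right hle Q.A_bs_nonneg) Q.half_bs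
    have e1 : κ' * Q.emin / (4 * (Q.Mρ * Q.emax + Q.Me)) = κ' * (Q.emin / (4 * (Q.Mρ * Q.emax + Q.Me))) := by ring
    rw [e1]; linarith
  condF1c := by
    have h := le_trans (mul_le_mul_of_nonneg_right hle Q.A_F1_nonneg) Q.half_F1
    have e1 : c.cmax * κ' * Q.emax + c.QF * Q.MΘ * (κ' * Q.emin / (4 * (Q.Mρ * Q.emax + Q.Me)) + 2 * c.cmax * κ' * Q.emax / (c.qminc * Q.mΘ)) =
        κ' * (c.cmax * Q.emax + c.QF * Q.MΘ * (Q.emin / (4 * (Q.Mρ * Q.emax + Q.Me)) + 2 * c.cmax * Q.emax / (c.qminc * Q.mΘ))) := by ring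
    rw [e1]; linarith
  condF1c' := by
    have h := le_trans (mul_le_mul_of_nonneg_right hle Q.A_F1p_nonneg) Q.half_F1p
    have e1 : 8 * c.cmax * (c.cmax * κ' * Q.emax +
        c.QF * Q.MΘ * (κ' * Q.emin / (4 * (Q.Mρ * Q.emax + Q.Me)) + 2 * c.cmax * κ' * Q.emax / (c.qminc * Q.mΘ))) =
        κ' * (8 * c.cmax * (c.cmax * Q.emax +
          c.QF * Q.MΘ * (Q.emin / (4 * (Q.Mρ * Q.emax + Q.Me)) + 2 * c.cmax * Q.emax / (c.qminc * Q.mΘ)))) := by ring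
    rw [e1]; linarith
  condF2c := by
    have h := le_trans (mul_le_mul_of_nonneg_right hle Q.A_F2_nonneg) Q.half_F2
    have hl := Q.lam_pos
    have e1 : 16 * (c.QF * Q.MΘ) * (c.cmax * κ' * Q.emax +
        c.QF * Q.MΘ * (κ' * Q.emin / (4 * (Q.Mρ * Q.emax + Q.Me)) + 2 * c.cmax * κ' * Q.emax / (c.qminc * Q.mΘ))) =
        κ' * (16 * (c.QF * Q.MΘ) * (c.cmax * Q.emax +
          c.QF * Q.MΘ * (Q.emin / (4 * (Q.Mρ * Q.emax + Q.Me)) + 2 * c.cmax * Q.emax / (c.qminc * Q.mΘ)))) := by ring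
    rw [e1]; linarith


/-- `toSlideChoice'_κD` (auxiliary). [folklore] -/
@[simp] theorem toSlideChoice'_κD (κ' : ℝ) (hκ0 : 0 < κ') (hle : κ' ≤ Q.κD) : (Q.toSlideChoice' κ' hκ0 hle).κD = κ' := rfl

end PreChoice

/-- **A parameter record with tip depth below any prescribed bound.** [cite: Kirby1989, Ch. I §4] -/
theorem exists_slideChoice_le (c : BandCore A B avoid) {e : ℝ → ℝ} (he : ContDiffOn ℝ ∞ e (Ioo (10⁻¹ : ℝ) (9 / 10)))
    (hpos : ∀ h ∈ Ioo (10⁻¹ : ℝ) (9 / 10), 0 < e h) {κmax : ℝ} (hκ : 0 < κmax) :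
    ∃ P : c.SlideChoice e, P.κD ≤ κmax := by
  obtain ⟨Q⟩ := c.exists_preChoice he hpos
  refine ⟨Q.toSlideChoice' (min Q.κD κmax) (lt_min Q.κD_pos hκ) (min_le_left _ _), ?_⟩
  show min Q.κD κmax ≤ κmax
  exact min_le_right _ _

end BandCore

end Literature.Topology.FourManifolds
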